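import Summits.KontsevichZagierPeriods.KontsevichZagierPeriods.Theorems.OctahedralSymmetrySimplexDilationMove
import Literature.NumberTheory.Transcendental.CyclotomicSimplexRep
import Literature.NumberTheory.Transcendental.KZGroundingRelations
import Literature.NumberTheory.Transcendental.KZSubcalculusInvariants
import Literature.NumberTheory.Transcendental.KZLogCalculusProofs

/-!
# `ZhaoRelationInKZ` (stmt-KontsevichZagierPeriods-9433, route `OctahedralSymmetry`), line `Sketch`:
# stub `stub_dil2` — the weight-2 distribution relations `t ↦ t²` inside the KZ calculus

For a LEVEL-2 word `U = (u₀, u₁)` (poles `u₀ ∈ {−1, 0}` = letters `2, 4`; `u₁ ∈ {1, −1}` =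
letters `0, 2`) the iterated integral `I(U) = ∫_{1 > t₀ > t₁ > 0} dt₀dt₁/((t₀ − p₀)(t₁ − p₁))`
is real, and the order-preserving bijection `t ↦ (t₀², t₁²)` of the open ordered simplex `Δ₂`
(Jacobian `(2t₀)(2t₁) > 0`) followed by the partial fractions
`2t/(t² − b) = 1/(t − √b) + 1/(t + √b)` (letter table `LevelFour.dilLetter`:
`ω₁ ↦ ω₁ + ω₋₁`, `ω₋₁ ↦ ωᵢ + ω₋ᵢ`, `ω₀ ↦ 2ω₀`) writes `I(U) = Σ_{(c,V) ∈ expand dil U} c · I(V)`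
[Zhao 2010, §5, distribution]. Inside the Kontsevich–Zagier calculus this is

* ONE change of variables (rule (2)): the route's support item `SimplexDilationMove`
  (`simplexDilationMove_proof`, PROVED in the tree) applied to the pulled-back representation
  `t ↦ F_U(t₀², t₁²) · (2t₀)(2t₁)` on `Δ₂` — which EXISTS as KZ data because, pointwise on `Δ₂`,
  it is the finite `ℕ`-combination `Σ c · F_V(t)` of the (semialgebraic, absolutely integrable)
  word integrands of the convergent words `V`;
* followed by integrand additivity (rule (1b)) with positive integer coefficients
  (`KZ.of_sub_sum_integrand_mem_relations`, `KZ.IntegralRep.of_constMul_nat_sub_nsmul_mem_relations`).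

Taking real parts gives the first conjunct of `stub_dil2`, imaginary parts the second; the third
(`Im I(U) ≡ 0`) is the vanishing of the imaginary integrand of a real word (rule (1b) with the
zero representation). The four words `U ∈ {(2,0), (2,2), (4,0), (4,2)}` are treated by one
parametrised engine (`dil2_case`) fed with the three one-letter identities
(`dil2_letter0/2/4_sum`).

References: J. Zhao, *Standard relations of multiple polylogarithm values at roots of unity*,
Doc. Math. 15 (2010), arXiv:0707.1459, §5; M. Kontsevich, D. Zagier, *Periods* (2001), §1.2.
-/

noncomputable section

open Set MeasureTheory
open Literature.NumberTheory.Transcendental Literature.NumberTheory.Transcendental.KZ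
open Summit.KontsevichZagierPeriods.OctahedralSymmetry.SimplexDilationMove
  (simplexDilationMove_proof)

namespace Summit.KontsevichZagierPeriods.OctahedralSymmetry.ZhaoRelationInKZ

/-! ## One-letter identities: `d(t²)/(t² − b) = Σ c · dt/(t − b')` -/

/-- The two-letter word integrand is the product of its two letters:
`F_{(a,b)}(s) = (s₀ − a)⁻¹ (s₁ − b)⁻¹`. [folklore] -/
theorem dil2_integrandC_pair (a b : Fin 5) (s : Fin 2 → ℝ) :
    levelFourIntegrandC [a, b] s = levelFourFactor a (s 0) * levelFourFactor b (s 1) := by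
  show ∏ j : Fin 2, levelFourFactor ([a, b].get j) (s j) = _
  rw [Fin.prod_univ_two]
  rfl

/-- Real part of a letter: `Re (re_m + i·im_m) = re_m`. [folklore] -/
theorem dil2_factor_re (m : Fin 5) (x : ℝ) : (levelFourFactor m x).re = levelFourRe m x := by
  simp [levelFourFactor]

/-- Imaginary part of a letter: `Im (re_m + i·im_m) = im_m`. [folklore] -/
theorem dil2_factor_im (m : Fin 5) (x : ℝ) : (levelFourFactor m x).im = levelFourIm m x := by
  simp [levelFourFactor]

/-- Pole `0` (letter `4`): `2x/x² = 2/x` for `x ≠ 0`. [cite: Zhao2010, §5] -/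
theorem dil2_letter4 {x : ℝ} (hx : 0 < x) :
    levelFourFactor 4 (x ^ 2) * (((2 * x : ℝ)) : ℂ) = 2 * levelFourFactor 4 x := by
  rw [levelFourFactor_eq, levelFourFactor_eq]
  simp only [levelFourPole, Matrix.cons_val]
  have hx' : (x : ℂ) ≠ 0 := by exact_mod_cast hx.ne'
  push_cast
  field_simp
  ring

/-- Pole `1` (letter `0`): `2x/(x² − 1) = 1/(x − 1) + 1/(x + 1)` for `0 < x < 1`.
[cite: Zhao2010, §5] -/
theorem dil2_letter0 {x : ℝ} (hx : 0 < x) (hx1 : x < 1) :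
    levelFourFactor 0 (x ^ 2) * (((2 * x : ℝ)) : ℂ) =
      levelFourFactor 0 x + levelFourFactor 2 x := by
  rw [levelFourFactor_eq, levelFourFactor_eq, levelFourFactor_eq]
  simp only [levelFourPole, Matrix.cons_val]
  have h1 : (x : ℂ) - 1 ≠ 0 := by
    rw [sub_ne_zero]; exact_mod_cast hx1.ne
  have h2 : (x : ℂ) - -1 ≠ 0 := by
    rw [sub_neg_eq_add]
    have : (0 : ℝ) < x + 1 := by linarith
    exact_mod_cast this.ne'
  have h3 : ((x ^ 2 : ℝ) : ℂ) - 1 ≠ 0 := by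
    have : ((x ^ 2 : ℝ) : ℂ) - 1 = ((x : ℂ) - 1) * ((x : ℂ) - -1) := by push_cast; ring
    rw [this]; exact mul_ne_zero h1 h2
  push_cast at h3 ⊢
  field_simp
  ring

/-- Pole `−1` (letter `2`): `2x/(x² + 1) = 1/(x − i) + 1/(x + i)` for real `x`.
[cite: Zhao2010, §5] -/
theorem dil2_letter2 (x : ℝ) :
    levelFourFactor 2 (x ^ 2) * (((2 * x : ℝ)) : ℂ) =
      levelFourFactor 1 x + levelFourFactor 3 x := by
  rw [levelFourFactor_eq, levelFourFactor_eq, levelFourFactor_eq]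
  simp only [levelFourPole, Matrix.cons_val]
  have h1 : (x : ℂ) - Complex.I ≠ 0 := by
    intro h
    have := congrArg Complex.im h
    simp at this
  have h2 : (x : ℂ) - -Complex.I ≠ 0 := by
    intro h
    have := congrArg Complex.im h
    simp at this
  have h3 : ((x ^ 2 : ℝ) : ℂ) - -1 ≠ 0 := by
    have : ((x ^ 2 : ℝ) : ℂ) - -1 = ((x : ℂ) - Complex.I) * ((x : ℂ) - -Complex.I) := by
      push_cast; ring_nf; rw [Complex.I_sq]; ring
    rw [this]; exact mul_ne_zero h1 h2
  push_cast at h3 ⊢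
  field_simp
  ring_nf
  rw [Complex.I_sq]
  ring

/-- Letter `0` in tabulated form: `f₀(x²)·2x = Σᵢ cᵢ f_{βᵢ}(x)` with `c = (1, 1)`, `β = (0, 2)`
(the entry `dilLetter 0 = [(1,0),(1,2)]`). [cite: Zhao2010, §5] -/
theorem dil2_letter0_sum (x : ℝ) (hx : 0 < x) (hx1 : x < 1) :
    levelFourFactor 0 (x ^ 2) * (((2 * x : ℝ)) : ℂ) =
      ∑ i : Fin 2, ((((![1, 1] : Fin 2 → ℕ) i : ℕ) : ℝ) : ℂ) *
        levelFourFactor ((![0, 2] : Fin 2 → Fin 5) i) x := by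
  rw [dil2_letter0 hx hx1, Fin.sum_univ_two]
  simp

/-- Letter `2` in tabulated form: `f₂(x²)·2x = Σᵢ cᵢ f_{βᵢ}(x)` with `c = (1, 1)`, `β = (1, 3)`
(the entry `dilLetter 2 = [(1,1),(1,3)]`). [cite: Zhao2010, §5] -/
theorem dil2_letter2_sum (x : ℝ) (_hx : 0 < x) (_hx1 : x < 1) :
    levelFourFactor 2 (x ^ 2) * (((2 * x : ℝ)) : ℂ) =
      ∑ i : Fin 2, ((((![1, 1] : Fin 2 → ℕ) i : ℕ) : ℝ) : ℂ) *
        levelFourFactor ((![1, 3] : Fin 2 → Fin 5) i) x := by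
  rw [dil2_letter2 x, Fin.sum_univ_two]
  simp

/-- Letter `4` in tabulated form: `f₄(x²)·2x = Σᵢ cᵢ f_{βᵢ}(x)` with `c = (2)`, `β = (4)`
(the entry `dilLetter 4 = [(2,4)]`). [cite: Zhao2010, §5] -/
theorem dil2_letter4_sum (x : ℝ) (hx : 0 < x) (_hx1 : x < 1) :
    levelFourFactor 4 (x ^ 2) * (((2 * x : ℝ)) : ℂ) =
      ∑ i : Fin 1, ((((![2] : Fin 1 → ℕ) i : ℕ) : ℝ) : ℂ) *
        levelFourFactor ((![4] : Fin 1 → Fin 5) i) x := by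
  rw [dil2_letter4 hx, Fin.sum_univ_one]
  simp

/-! ## The engine: one change of variables plus integrand additivity -/

/-- **The dilation engine.** If `r'` is a representation on `Δ₂` and, pointwise on `Δ₂`,
`r'.integrand (t₀², t₁²) · (2t₀)(2t₁) = Σᵢ cᵢ · (S i).integrand t` with natural coefficients
`cᵢ` and representations `S i` on `Δ₂`, then `[r'] − Σᵢ cᵢ • [S i] ∈ KZ.relations`: the
pulled-back representation `r` (integrand LITERALLY `r'.integrand ∘ (·)² · Jacobian`, semialgebraic
and absolutely integrable because it agrees on `Δ₂` with the finite sum `Σᵢ cᵢ (S i).integrand`)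
satisfies `[r] − [r'] ∈ changeOfVariablesRel` by `SimplexDilationMove` (rule (2)), and
`[r] − Σᵢ [cᵢ · S i]`, `[cᵢ · S i] − cᵢ • [S i]` are integrand additivity (rule (1b)).
[cite: KontsevichZagier2001, §1.2 rule (2)] -/
theorem dil2_engine {ι : Type*} [Fintype ι] (r' : IntegralRep 2)
    (hr' : r'.domain = openOrderedSimplex 2)
    (c : ι → ℕ) (S : ι → IntegralRep 2) (hS : ∀ i, (S i).domain = openOrderedSimplex 2)
    (hpt : ∀ t ∈ openOrderedSimplex 2,
      r'.integrand (fun j => t j ^ 2) * ∏ j, (2 * t j) = ∑ i, (c i : ℝ) * (S i).integrand t) :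
    of r' - ∑ i, (c i : ℤ) • of (S i) ∈ relations := by
  classical
  set R : ι → IntegralRep 2 := fun i => (S i).constMul (c i : ℝ) (isAlgebraic_nat (c i)) with hR
  have hRd : ∀ i, (R i).domain = openOrderedSimplex 2 := fun i => hS i
  have hRsa : ∀ i, IsSemialgebraicFunOn ℚ (openOrderedSimplex 2) (R i).integrand := fun i => by
    rw [← hRd i]; exact (R i).isSemialgebraicFunOn_integrand
  have hRint : ∀ i, IntegrableOn (R i).integrand (openOrderedSimplex 2) := fun i => by
    rw [← hRd i]; exact (R i).integrableOn
  have hsa : IsSemialgebraicFunOn ℚ (openOrderedSimplex 2) (fun t => ∑ i, (R i).integrand t) :=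
    isSemialgebraicFunOn_finset_sum Finset.univ (isSemialgebraic_openOrderedSimplex 2)
      fun i _ => hRsa i
  have hint : IntegrableOn (fun t => ∑ i, (R i).integrand t) (openOrderedSimplex 2) :=
    integrable_finsetSum Finset.univ fun i _ => hRint i
  have hpt' : EqOn (fun t => ∑ i, (R i).integrand t)
      (fun t => r'.integrand (fun j => t j ^ 2) * ∏ j, (2 * t j)) (openOrderedSimplex 2) := by
    intro t ht
    simp only [hR, IntegralRep.integrand_constMul]
    exact (hpt t ht).symm
  -- the pulled-back representation on `Δ₂`
  let r : IntegralRep 2 :=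
    { domain := openOrderedSimplex 2
      integrand := fun t => r'.integrand (fun j => t j ^ 2) * ∏ j, (2 * t j)
      isSemialgebraic_domain := isSemialgebraic_openOrderedSimplex 2
      isSemialgebraicFunOn_integrand := hsa.congr hpt'
      integrableOn := hint.congr_fun hpt' (measurableSet_openOrderedSimplex 2) }
  -- ONE change of variables (rule (2))
  have h1 : of r - of r' ∈ relations :=
    changeOfVariablesRel_subset_relations
      (simplexDilationMove_proof 2 r r' rfl hr' fun t _ => rfl)
  -- integrand additivity (rule (1b))
  have h2 : of r - ∑ i, of (R i) ∈ relations :=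
    of_sub_sum_integrand_mem_relations Finset.univ R r (fun i _ => hRd i)
      fun t ht => (hpt' ht).symm
  -- integer scaling is integrand additivity
  have h3 : ∑ i, (of (R i) - (c i : ℤ) • of (S i)) ∈ relations := by
    refine sum_mem fun i _ => ?_
    rw [natCast_zsmul]
    exact (S i).of_constMul_nat_sub_nsmul_mem_relations (c i)
  have e : of r' - ∑ i, (c i : ℤ) • of (S i) =
      (of r - ∑ i, of (R i)) - (of r - of r') + ∑ i, (of (R i) - (c i : ℤ) • of (S i)) := by
    rw [Finset.sum_sub_distrib]; abel
  rw [e]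
  exact relations.add_mem (relations.sub_mem h2 h1) h3

/-- **One distribution instance, both parts.** For a convergent two-letter word `(u₀, u₁)` whose
letters satisfy tabulated one-letter identities `f_{u}(x²)·2x = Σ c f_β(x)` on `(0,1)` with all
product words `(β₀ i, β₁ j)` convergent: pointwise on `Δ₂`,
`F_U(t₀², t₁²)·(2t₀)(2t₁) = Σᵢⱼ c₀ᵢc₁ⱼ F_{(β₀ i, β₁ j)}(t)` (complex), whose real and imaginary
parts feed `dil2_engine` for the canonical representations of `Re I`, `Im I`.
[cite: Zhao2010, §5] -/
theorem dil2_case (u₀ u₁ : Fin 5) (hU : LevelFour.IsConvergent [u₀, u₁])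
    {k₀ k₁ : ℕ} (c₀ : Fin k₀ → ℕ) (β₀ : Fin k₀ → Fin 5) (c₁ : Fin k₁ → ℕ) (β₁ : Fin k₁ → Fin 5)
    (e₀ : ∀ x : ℝ, 0 < x → x < 1 →
      levelFourFactor u₀ (x ^ 2) * (((2 * x : ℝ)) : ℂ) =
        ∑ i, (((c₀ i : ℕ) : ℝ) : ℂ) * levelFourFactor (β₀ i) x)
    (e₁ : ∀ x : ℝ, 0 < x → x < 1 →
      levelFourFactor u₁ (x ^ 2) * (((2 * x : ℝ)) : ℂ) =
        ∑ j, (((c₁ j : ℕ) : ℝ) : ℂ) * levelFourFactor (β₁ j) x)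
    (hb : ∀ i j, LevelFour.IsConvergent [β₀ i, β₁ j])
    (Zr Zi : List (Fin 5) → FormalRep)
    (hZr : ∀ (W : List (Fin 5)) (h : LevelFour.IsConvergent W),
      Zr W = of (levelFourRepRe W (integrableOn_levelFourIntegrandC h)))
    (hZi : ∀ (W : List (Fin 5)) (h : LevelFour.IsConvergent W),
      Zi W = of (levelFourRepIm W (integrableOn_levelFourIntegrandC h))) :
    Zr [u₀, u₁] - ∑ i, ∑ j, ((c₀ i * c₁ j : ℕ) : ℤ) • Zr [β₀ i, β₁ j] ∈ relations ∧
    Zi [u₀, u₁] - ∑ i, ∑ j, ((c₀ i * c₁ j : ℕ) : ℤ) • Zi [β₀ i, β₁ j] ∈ relations := by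
  -- the complex pointwise identity on `Δ₂`
  have hC : ∀ t ∈ openOrderedSimplex 2,
      levelFourIntegrandC [u₀, u₁] (fun j : Fin 2 => t j ^ 2) * (((∏ j, (2 * t j) : ℝ)) : ℂ) =
        ∑ p : Fin k₀ × Fin k₁, (((c₀ p.1 * c₁ p.2 : ℕ) : ℝ) : ℂ) *
          levelFourIntegrandC [β₀ p.1, β₁ p.2] t := by
    rintro t ⟨h0, h1, -⟩
    rw [dil2_integrandC_pair, Fin.prod_univ_two, Fintype.sum_prod_type]
    simp only [dil2_integrandC_pair]
    rw [Complex.ofReal_mul, show levelFourFactor u₀ (t 0 ^ 2) * levelFourFactor u₁ (t 1 ^ 2) *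
        ((((2 * t 0 : ℝ)) : ℂ) * (((2 * t 1 : ℝ)) : ℂ)) =
        (levelFourFactor u₀ (t 0 ^ 2) * (((2 * t 0 : ℝ)) : ℂ)) *
          (levelFourFactor u₁ (t 1 ^ 2) * (((2 * t 1 : ℝ)) : ℂ)) by ring,
      e₀ _ (h0 0) (h1 0), e₁ _ (h0 1) (h1 1), Fintype.sum_mul_sum]
    refine Finset.sum_congr rfl fun i _ => Finset.sum_congr rfl fun j _ => ?_
    push_cast
    ring
  -- its real and imaginary parts
  have eRe : ∀ t ∈ openOrderedSimplex 2,
      levelFourIntegrandRe [u₀, u₁] (fun j : Fin 2 => t j ^ 2) * ∏ j, (2 * t j) =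
        ∑ p : Fin k₀ × Fin k₁, ((c₀ p.1 * c₁ p.2 : ℕ) : ℝ) *
          levelFourIntegrandRe [β₀ p.1, β₁ p.2] t := fun t ht => by
    have h := congrArg Complex.re (hC t ht)
    simpa only [levelFourIntegrandRe, Complex.re_mul_ofReal, Complex.re_sum,
      Complex.re_ofReal_mul] using h
  have eIm : ∀ t ∈ openOrderedSimplex 2,
      levelFourIntegrandIm [u₀, u₁] (fun j : Fin 2 => t j ^ 2) * ∏ j, (2 * t j) =
        ∑ p : Fin k₀ × Fin k₁, ((c₀ p.1 * c₁ p.2 : ℕ) : ℝ) *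
          levelFourIntegrandIm [β₀ p.1, β₁ p.2] t := fun t ht => by
    have h := congrArg Complex.im (hC t ht)
    simpa only [levelFourIntegrandIm, Complex.im_mul_ofReal, Complex.im_sum,
      Complex.im_ofReal_mul] using h
  constructor
  · have h := dil2_engine (ι := Fin k₀ × Fin k₁)
      (levelFourRepRe [u₀, u₁] (integrableOn_levelFourIntegrandC hU)) rfl
      (fun p => c₀ p.1 * c₁ p.2)
      (fun p => levelFourRepRe [β₀ p.1, β₁ p.2] (integrableOn_levelFourIntegrandC (hb p.1 p.2)))
      (fun _ => rfl) eRe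
    rw [Fintype.sum_prod_type] at h
    rw [hZr _ hU, Finset.sum_congr rfl fun i _ => Finset.sum_congr rfl fun j _ => by
      rw [hZr _ (hb i j)]]
    exact h
  · have h := dil2_engine (ι := Fin k₀ × Fin k₁)
      (levelFourRepIm [u₀, u₁] (integrableOn_levelFourIntegrandC hU)) rfl
      (fun p => c₀ p.1 * c₁ p.2)
      (fun p => levelFourRepIm [β₀ p.1, β₁ p.2] (integrableOn_levelFourIntegrandC (hb p.1 p.2)))
      (fun _ => rfl) eIm
    rw [Fintype.sum_prod_type] at h
    rw [hZi _ hU, Finset.sum_congr rfl fun i _ => Finset.sum_congr rfl fun j _ => by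
      rw [hZi _ (hb i j)]]
    exact h

/-- **A real word has vanishing imaginary part**: if both letters of the convergent word
`(u₀, u₁)` have `im ≡ 0` then `Im F_U = re₀·im₁ + im₀·re₁ ≡ 0` on `Δ₂`, so the canonical
representation of `Im I(U)` is a relation (rule (1b) against the zero representation).
[folklore] -/
theorem dil2_imZero (u₀ u₁ : Fin 5) (hU : LevelFour.IsConvergent [u₀, u₁])
    (h₀ : ∀ x, levelFourIm u₀ x = 0) (h₁ : ∀ x, levelFourIm u₁ x = 0)
    (Zi : List (Fin 5) → FormalRep)
    (hZi : ∀ (W : List (Fin 5)) (h : LevelFour.IsConvergent W),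
      Zi W = of (levelFourRepIm W (integrableOn_levelFourIntegrandC h))) :
    Zi [u₀, u₁] ∈ relations := by
  rw [hZi _ hU]
  refine of_mem_relations_of_eqOn_zero _ fun t _ => ?_
  have e := dil2_integrandC_pair u₀ u₁ t
  show (levelFourIntegrandC [u₀, u₁] t).im = 0
  rw [e, Complex.mul_im, dil2_factor_im, dil2_factor_im, h₀, h₁]
  ring

/-! ## The stub -/

/-- **Stub `stub_dil2`** (engine dil, weight 2): for a level-2 word `U = (u₀, u₁)` (poles
`u₀ ∈ {−1, 0}`, `u₁ ∈ {1, −1}`) the order-preserving change of variables `t ↦ (t₀², t₁²)` on `Δ₂`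
(`simplexDilationMove_proof`, |J| = 4t₀t₁) followed by `2t dt/(t² − b) = dt/(t − √b) + dt/(t + √b)`
(rule (1b)) gives `Re I(U) ≡ Σ c Re I(V)`, `Im I(U) ≡ Σ c Im I(V)` over `expand dil U`; and
`Im I(U) ≡ 0` (a real word has identically vanishing imaginary integrand). [cite: Zhao2010, §5] -/
theorem stub_dil2 (Zr Zi : List (Fin 5) → FormalRep)
    (hZr : ∀ (W : List (Fin 5)) (h : LevelFour.IsConvergent W),
      Zr W = of (levelFourRepRe W (integrableOn_levelFourIntegrandC h)))
    (hZi : ∀ (W : List (Fin 5)) (h : LevelFour.IsConvergent W),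
      Zi W = of (levelFourRepIm W (integrableOn_levelFourIntegrandC h)))
    (u₀ u₁ : Fin 5) (hu₀ : u₀ = 2 ∨ u₀ = 4) (hu₁ : u₁ = 0 ∨ u₁ = 2) :
    Zr [u₀, u₁] - ((LevelFour.expand LevelFour.dilLetter [u₀, u₁]).map
        fun cV => cV.1 • Zr cV.2).sum ∈ relations ∧
    Zi [u₀, u₁] - ((LevelFour.expand LevelFour.dilLetter [u₀, u₁]).map
        fun cV => cV.1 • Zi cV.2).sum ∈ relations ∧
    Zi [u₀, u₁] ∈ relations := by
  rcases hu₀ with rfl | rfl <;> rcases hu₁ with rfl | rfl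
  · -- `U = (−1, 1)`: `expand dil [2, 0] = [1,0] + [1,2] + [3,0] + [3,2]`
    obtain ⟨hre, him⟩ := dil2_case 2 0 (by decide) (k₀ := 2) (k₁ := 2) ![1, 1] ![1, 3]
      ![1, 1] ![0, 2] dil2_letter2_sum dil2_letter0_sum (by decide) Zr Zi hZr hZi
    rw [show LevelFour.expand LevelFour.dilLetter [2, 0] =
      [(1, [1, 0]), (1, [1, 2]), (1, [3, 0]), (1, [3, 2])] from by decide]
    simp only [Fin.sum_univ_two, Matrix.cons_val_zero, Matrix.cons_val_one, mul_one, Nat.cast_one,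
      one_smul] at hre him
    simp only [List.map_cons, List.map_nil, List.sum_cons, List.sum_nil, one_smul, add_zero]
    exact ⟨by convert hre using 2; abel, by convert him using 2; abel,
      dil2_imZero 2 0 (by decide) levelFourIm_two levelFourIm_zero Zi hZi⟩
  · -- `U = (−1, −1)`: `expand dil [2, 2] = [1,1] + [1,3] + [3,1] + [3,3]`
    obtain ⟨hre, him⟩ := dil2_case 2 2 (by decide) (k₀ := 2) (k₁ := 2) ![1, 1] ![1, 3]
      ![1, 1] ![1, 3] dil2_letter2_sum dil2_letter2_sum (by decide) Zr Zi hZr hZi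
    rw [show LevelFour.expand LevelFour.dilLetter [2, 2] =
      [(1, [1, 1]), (1, [1, 3]), (1, [3, 1]), (1, [3, 3])] from by decide]
    simp only [Fin.sum_univ_two, Matrix.cons_val_zero, Matrix.cons_val_one, mul_one, Nat.cast_one,
      one_smul] at hre him
    simp only [List.map_cons, List.map_nil, List.sum_cons, List.sum_nil, one_smul, add_zero]
    exact ⟨by convert hre using 2; abel, by convert him using 2; abel,
      dil2_imZero 2 2 (by decide) levelFourIm_two levelFourIm_two Zi hZi⟩
  · -- `U = (0, 1)`: `expand dil [4, 0] = 2[4,0] + 2[4,2]`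
    obtain ⟨hre, him⟩ := dil2_case 4 0 (by decide) (k₀ := 1) (k₁ := 2) ![2] ![4]
      ![1, 1] ![0, 2] dil2_letter4_sum dil2_letter0_sum (by decide) Zr Zi hZr hZi
    rw [show LevelFour.expand LevelFour.dilLetter [4, 0] = [(2, [4, 0]), (2, [4, 2])] from by decide]
    simp only [Fin.sum_univ_two, Fin.sum_univ_one, Matrix.cons_val_zero, Matrix.cons_val_one,
      Matrix.cons_val_fin_one, mul_one, Nat.cast_ofNat] at hre him
    simp only [List.map_cons, List.map_nil, List.sum_cons, List.sum_nil, add_zero]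
    exact ⟨by convert hre using 2, by convert him using 2,
      dil2_imZero 4 0 (by decide) levelFourIm_four levelFourIm_zero Zi hZi⟩
  · -- `U = (0, −1)`: `expand dil [4, 2] = 2[4,1] + 2[4,3]`
    obtain ⟨hre, him⟩ := dil2_case 4 2 (by decide) (k₀ := 1) (k₁ := 2) ![2] ![4]
      ![1, 1] ![1, 3] dil2_letter4_sum dil2_letter2_sum (by decide) Zr Zi hZr hZi
    rw [show LevelFour.expand LevelFour.dilLetter [4, 2] = [(2, [4, 1]), (2, [4, 3])] from by decide]
    simp only [Fin.sum_univ_two, Fin.sum_univ_one, Matrix.cons_val_zero, Matrix.cons_val_one,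
      Matrix.cons_val_fin_one, mul_one, Nat.cast_ofNat] at hre him
    simp only [List.map_cons, List.map_nil, List.sum_cons, List.sum_nil, add_zero]
    exact ⟨by convert hre using 2, by convert him using 2,
      dil2_imZero 4 2 (by decide) levelFourIm_four levelFourIm_two Zi hZi⟩

end Summit.KontsevichZagierPeriods.OctahedralSymmetry.ZhaoRelationInKZ

end
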